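import Mathlib
import Literature.Analysis.FluidPDE.Tao2016AveragedNS.BoundedEternalSolutions
import Summits.NavierStokesRegularity.NavierStokesRegularity.Theses.TaoLadderRungTwoBreak
import Summits.NavierStokesRegularity.NavierStokesRegularity.Theses.WakeRatchet
import Summits.NavierStokesRegularity.NavierStokesRegularity.Theorems.TaoLadderRungTwoBreakNoSurvivingEternalViscBddOneLinks
import Summits.NavierStokesRegularity.NavierStokesRegularity.Theorems.TaoLadderRungTwoBreakNoSurvivingEternalViscBddOneOfWakeRatchet
import HarnessLib

/-!
# K1(1) `TaoLadderRungTwoBreak.NoSurvivingDSSOne` (stmt-NavierStokesRegularity-20205) is CUT BY NAME by the rate cruxes of route `WakeRatchet`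

MODEL lattice ODEs only (Tao 2016 §4, §6.4); nothing here is a statement about the Navier–Stokes equations; no stub, crux or summit is
closed (`--supports stmt-NavierStokesRegularity-20205`; the hypotheses are OPEN route items of route WakeRatchet, taken BY NAME).

Composition of this hand's by-name cuts for ⟨20419⟩ (`…NoSurvivingEternalViscBddOneOfWakeRatchet`) with the landed links
`noSurvivingDSSOne_of_noSurvivingEternalBddOne` / `…_of_noSurvivingEternalViscBddOne` (`…Links`): every admissible DSS wave embeds as a
uniformly bounded admissible inviscid eternal solution, so

* `noSurvivingDSSOne_of_eternalInviscidRate` — **crux ⟨20205⟩ ⟸ WakeRatchet ⟨25646⟩ `EternalInviscidRate`** (the INVISCID rate ratchet alone);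
* `noSurvivingDSSOne_of_tailRateRatchet` — **crux ⟨20205⟩ ⟸ WakeRatchet's deciding crux ⟨25584⟩ `TailRateRatchet`**.

READING for the census: the rev-1 crux K1(1) (surviving DSS waves) sits below BOTH routes' deciding cruxes; the open stub
`stub_eternalLiouville` of ⟨20205⟩'s registered skeleton (unbounded inviscid Liouville) is NOT implied by these (it is stronger than (ρ0)),
which is one more reason to reshape it to (ρ0) as census v6.1 recommends.  The numerics of this hand (evidence
`NUMERICS-20419-wake-exponent-leafhand4-g0.md` on ⟨20205⟩) find no surviving period-1 DSS front on the dyadic / pump members of E₂(2)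
(retention exponent a ≥ 1.207 > 1 at every ε₀ tried, → 5/3 as ε₀ → 0).  HONEST LABEL: by-name bookkeeping; ⟨20205⟩, ⟨25584⟩, ⟨25646⟩
and every NS statement remain OPEN.
-/

noncomputable section

-- the summit and its single sub-problem share the name (CONVENTIONS §1)
set_option linter.dupNamespace false

namespace Summit.NavierStokesRegularity.NavierStokesRegularity.Theorems.NoSurvivingDSSOne.OfWakeRatchet

open Literature.Analysis.FluidPDE Literature.Analysis.FluidPDE.TaoCascade
open Summit.NavierStokesRegularity.NavierStokesRegularity.Theses
open Summit.NavierStokesRegularity.NavierStokesRegularity.Theorems.NoSurvivingEternalViscBddOne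
  (noSurvivingDSSOne_of_noSurvivingEternalBddOne noSurvivingDSSOne_of_noSurvivingEternalViscBddOne)
open Summit.NavierStokesRegularity.NavierStokesRegularity.Theorems.NoSurvivingEternalViscBddOne.OfWakeRatchet
  (stub_noSurvivingEternalBddOne_of_eternalInviscidRate noSurvivingEternalViscBddOne_of_tailRateRatchet)

/-- **Crux ⟨20205⟩ ⟸ WakeRatchet ⟨25646⟩.**  The inviscid rate ratchet `WakeRatchet.EternalInviscidRate` implies K1(1)
`TaoLadderRungTwoBreak.NoSurvivingDSSOne` BY NAME (through the (ρ0) statement `∀ R ≥ 1, NoSurvivingEternalBdd R 1` and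
`noSurvivingDSS_of_noSurvivingEternalBdd`).
[cite: Tao2016AveragedNS, §4 Thm. 4.2 (statement shape), (4.1)–(4.4), §6.4; tree links] -/
theorem noSurvivingDSSOne_of_eternalInviscidRate (hK : WakeRatchet.EternalInviscidRate) :
    TaoLadderRungTwoBreak.NoSurvivingDSSOne :=
  noSurvivingDSSOne_of_noSurvivingEternalBddOne (stub_noSurvivingEternalBddOne_of_eternalInviscidRate hK)

/-- **Crux ⟨20205⟩ ⟸ WakeRatchet ⟨25584⟩.**  The rate tail ratchet `WakeRatchet.TailRateRatchet` (any covariant viscosity) implies K1(1)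
`TaoLadderRungTwoBreak.NoSurvivingDSSOne` BY NAME (through the deciding crux ⟨20419⟩).
[cite: Tao2016AveragedNS, §4 Thm. 4.2 (statement shape), (4.1)–(4.4), §6.4; tree links] -/
theorem noSurvivingDSSOne_of_tailRateRatchet (hK : WakeRatchet.TailRateRatchet) :
    TaoLadderRungTwoBreak.NoSurvivingDSSOne :=
  noSurvivingDSSOne_of_noSurvivingEternalViscBddOne (noSurvivingEternalViscBddOne_of_tailRateRatchet hK)

end Summit.NavierStokesRegularity.NavierStokesRegularity.Theorems.NoSurvivingDSSOne.OfWakeRatchet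

end
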